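import Summits.CriticalPhenomena.PercolationContinuityZ3.Theorems.FK.InfiniteVolumeDLROneEdgeIff
import Literature.Probability.Percolation.BondPercolationSymmetry
import Literature.Probability.Percolation.DeletionTolerance
import Literature.Probability.Percolation.SiteConnectionTools
import HarnessLib

/-!
# FK-continuity transplant, FO-06/FO-10 (infinite-volume structure): the class `R_{p,q}` is invariant under the
# automorphisms of `ℤ^d` (Grimmett 2006, §4.4 with Thm. (4.19)(b): translations and signed coordinate permutations
# carry DLR random-cluster measures to DLR random-cluster measures)

Registered R95 (cell INBOX l.6599, 2026-08-24); registry row FO-10b-g410; label DNX-A (coordinator fk-4 g198).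
Cell `fk-continuity` (bschramm), FO-10b lineage; `--supports stmt-CriticalPhenomena-4575`; builds on p205010 (kernel theorem,
internal audit signed; external expert review pending). CONDITIONAL cell (FH AND TP_FK open at the same `p` for `q > 1`; K1);
UNCONDITIONAL structure here (every `d`, `0 ≤ p ≤ 1`, `q > 0`); no defs / sorries; NOT a discharge, NOT `_r4`; n_open = 2.
Banked infinite-volume structure; not an END-STATE dependency of the cell (not consumed by `_r3`).

For a graph automorphism `φ` of `ℤ^d` (`zdGraph d ≃g zdGraph d`) and the induced relabelling of bond configurations
`τ = BondConfig.relabel (sym2Equiv φ)`: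

* `relabel_preimage_setOf_mk_mem`, `relabel_preimage_closeEdges_preimage`, `relabel_preimage_openConn` — the one-edge
  data of Grimmett's (4.38) (`J_e`, `ω ∖ e`, `K_e = {x ↔ y off e}`) are transported by `τ` to the one-edge data of the
  edge `φ⁻¹ e`;
* **`IsDLRRandomCluster.map_relabel_iso`** — **`P ∈ R_{p,q} ⇒ P ∘ τ⁻¹ ∈ R_{p,q}`** (`0 ≤ p ≤ 1`, `q > 0`): by FO-10b-g407's
  Prop. (4.37)(a)(b) (`isDLRRandomCluster_iff_oneEdge`) membership in `R_{p,q}` is the family of one-edge identities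
  (4.38), which `τ` permutes; `IsDLRRandomCluster.map_relabel_shift`, `IsDLRRandomCluster.map_relabel_signedPerm` —
  in particular `R_{p,q}` is invariant as a set under the translations and under the signed coordinate permutations
  (the members need not be: compare FO-06b `IsBoxLimit.map_relabel_shift` for `φ⁰_{p,q}`, `φ¹_{p,q}`);
* `ae_subset_edgeSet_map_relabel_iso` — `τ` carries lattice-carried measures (`P`-a.e. `ω ⊆ E(ℤ^d)`) to lattice-carried
  measures; `IsDLRRandomCluster.map_relabel_iso_eq_self_of_forall_eq` — when the LATTICE-CARRIED member of `R_{p,q}` is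
  unique, it is automorphism-invariant.  (Uniqueness is only meaningful among lattice-carried members: `BondConfig (Site d)`
  contains non-edge pairs, e.g. the diagonal `s(x, x)`, which the DLR kernels never touch, so `R_{p,q}` itself is never a
  singleton in this typing — coordinator fk-4 g198, ruling R95 finding (6); re-cut (θ2).)

## References

* G. Grimmett, *The Random-Cluster Model*, Springer 2006: Def. (4.29)–(4.30), Thm. (4.19)(b), Prop. (4.37)(a)(b)
  eq. (4.38), pp. 77–78, 81–83. [Grimmett2006]
-/

noncomputable section

open MeasureTheory Set

namespace Summit.CriticalPhenomena.PercolationContinuityZ3.Theorems.FK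

open Literature.Probability.Percolation Literature.Probability.LatticeModels

variable {d : ℕ} {p q : ℝ} {P : Measure (BondConfig (Site d))}

/-! ### Transport of the one-edge data under a relabelling -/

section Transport

variable {V : Type*} (φ : V ≃ V)

/-- `τ⁻¹ {e open} = {φ⁻¹ e open}`. [folklore] -/
theorem relabel_preimage_setOf_mk_mem (x y : V) :
    BondConfig.relabel (sym2Equiv φ) ⁻¹' {ω : BondConfig V | s(x, y) ∈ ω} = {ω | s(φ.symm x, φ.symm y) ∈ ω} := by
  ext ω
  rw [Set.mem_preimage, Set.mem_setOf_eq, Set.mem_setOf_eq, BondConfig.mem_relabel_iff, sym2Equiv_symm, sym2Equiv_mk]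

/-- `τ (ω ∖ {φ⁻¹ e}) = τ ω ∖ {e}`, in preimage form: `τ⁻¹ {ω ∖ e ∈ H} = {ω ∖ φ⁻¹ e ∈ τ⁻¹ H}`. [folklore] -/
theorem relabel_preimage_closeEdges_preimage (x y : V) (H : Set (BondConfig V)) :
    BondConfig.relabel (sym2Equiv φ) ⁻¹' ((fun η : BondConfig V => η \ {s(x, y)}) ⁻¹' H) =
      (fun η : BondConfig V => η \ {s(φ.symm x, φ.symm y)}) ⁻¹' (BondConfig.relabel (sym2Equiv φ) ⁻¹' H) := by
  ext ω
  simp only [Set.mem_preimage]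
  have hset : BondConfig.relabel (sym2Equiv φ) ω \ {s(x, y)} =
      BondConfig.relabel (sym2Equiv φ) (ω \ {s(φ.symm x, φ.symm y)}) := by
    ext z
    simp only [Set.mem_sdiff, Set.mem_singleton_iff, BondConfig.mem_relabel_iff]
    constructor
    · rintro ⟨hz, hne⟩
      refine ⟨hz, fun h => hne ?_⟩
      have := congrArg (sym2Equiv φ) h
      rwa [Equiv.apply_symm_apply, sym2Equiv_mk, φ.apply_symm_apply, φ.apply_symm_apply] at this
    · rintro ⟨hz, hne⟩
      refine ⟨hz, fun h => hne ?_⟩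
      rw [h, sym2Equiv_symm, sym2Equiv_mk]
  rw [hset]

/-- `τ⁻¹ {x ↔ y} = {φ⁻¹ x ↔ φ⁻¹ y}`: a relabelling is an isomorphism of open graphs. [folklore] -/
theorem relabel_preimage_openConn (x y : V) :
    BondConfig.relabel (sym2Equiv φ) ⁻¹' (openConn x y) = openConn (φ.symm x) (φ.symm y) := by
  ext ω
  let ψ : openGraph ω ≃g openGraph (BondConfig.relabel (sym2Equiv φ) ω) :=
    { toEquiv := φ, map_rel_iff' := fun {a b} => openGraph_relabel_adj_iff φ ω a b }
  have h := (SimpleGraph.Iso.reachable_iff (φ := ψ) (u := φ.symm x) (v := φ.symm y))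
  rw [show ψ (φ.symm x) = x from φ.apply_symm_apply x, show ψ (φ.symm y) = y from φ.apply_symm_apply y] at h
  exact h

end Transport

/-! ### `R_{p,q}` is carried to itself by the lattice automorphisms -/

section Invariance

/-- **`R_{p,q}` is invariant under the automorphisms of `ℤ^d`**: for a graph automorphism `φ` of `zdGraph d` and
`P ∈ R_{p,q}` (`0 ≤ p ≤ 1`, `q > 0`), the image measure `P ∘ τ⁻¹`, `τ = BondConfig.relabel (sym2Equiv φ)`, lies in
`R_{p,q}`.  Proof: membership in `R_{p,q}` is the family of one-edge identities (4.38)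
(`isDLRRandomCluster_iff_oneEdge`), and `τ` maps the identity at the edge `e` for `P ∘ τ⁻¹` to the identity at `φ⁻¹ e`
for `P`. [cite: Grimmett2006, Prop. (4.37)(a)(b) eq. (4.38), Thm. (4.19)(b)] -/
theorem IsDLRRandomCluster.map_relabel_iso (hP : IsDLRRandomCluster d p q P) (hp : p ∈ Set.Icc (0 : ℝ) 1) (hq : 0 < q)
    (φ : zdGraph d ≃g zdGraph d) :
    IsDLRRandomCluster d p q (P.map ⇑(BondConfig.relabel (sym2Equiv φ.toEquiv))) := by
  haveI := hP.isProbabilityMeasure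
  have hτ : Measurable ⇑(BondConfig.relabel (sym2Equiv φ.toEquiv)) := (BondConfig.relabel _).measurable
  haveI : IsProbabilityMeasure (P.map ⇑(BondConfig.relabel (sym2Equiv φ.toEquiv))) :=
    Measure.isProbabilityMeasure_map hτ.aemeasurable
  refine isDLRRandomCluster_of_oneEdge d hp hq fun x y hxy H₀ hH₀ => ?_
  -- the transported edge `φ⁻¹ e`
  have hxy' : (zdGraph d).Adj (φ.toEquiv.symm x) (φ.toEquiv.symm y) := (SimpleGraph.Iso.map_adj_iff φ.symm).2 hxy
  have hcl : ∀ u v : Site d, Measurable fun η : BondConfig (Site d) => η \ {s(u, v)} := fun u v =>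
    measurable_closeEdges _
  have hmap : ∀ {S : Set (BondConfig (Site d))}, MeasurableSet S →
      (P.map ⇑(BondConfig.relabel (sym2Equiv φ.toEquiv))).real S =
        P.real (⇑(BondConfig.relabel (sym2Equiv φ.toEquiv)) ⁻¹' S) := by
    intro S hS
    rw [measureReal_def, measureReal_def, Measure.map_apply hτ hS]
  have hK : MeasurableSet (openConn x y : Set (BondConfig (Site d))) := measurableSet_openConn_holds x y
  -- transport of the three events of (4.38)
  have h1 : ⇑(BondConfig.relabel (sym2Equiv φ.toEquiv)) ⁻¹' ({ω | s(x, y) ∈ ω} ∩ (fun η => η \ {s(x, y)}) ⁻¹' H₀) =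
      {ω | s(φ.toEquiv.symm x, φ.toEquiv.symm y) ∈ ω} ∩ (fun η => η \ {s(φ.toEquiv.symm x, φ.toEquiv.symm y)}) ⁻¹'
        (⇑(BondConfig.relabel (sym2Equiv φ.toEquiv)) ⁻¹' H₀) := by
    rw [Set.preimage_inter, relabel_preimage_setOf_mk_mem, relabel_preimage_closeEdges_preimage]
  have h2 : ⇑(BondConfig.relabel (sym2Equiv φ.toEquiv)) ⁻¹' ((fun η => η \ {s(x, y)}) ⁻¹' (H₀ ∩ openConn x y)) =
      (fun η => η \ {s(φ.toEquiv.symm x, φ.toEquiv.symm y)}) ⁻¹'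
        (⇑(BondConfig.relabel (sym2Equiv φ.toEquiv)) ⁻¹' H₀ ∩ openConn (φ.toEquiv.symm x) (φ.toEquiv.symm y)) := by
    rw [relabel_preimage_closeEdges_preimage, Set.preimage_inter, relabel_preimage_openConn]
  have h3 : ⇑(BondConfig.relabel (sym2Equiv φ.toEquiv)) ⁻¹' ((fun η => η \ {s(x, y)}) ⁻¹' (H₀ ∩ (openConn x y)ᶜ)) =
      (fun η => η \ {s(φ.toEquiv.symm x, φ.toEquiv.symm y)}) ⁻¹'
        (⇑(BondConfig.relabel (sym2Equiv φ.toEquiv)) ⁻¹' H₀ ∩ (openConn (φ.toEquiv.symm x) (φ.toEquiv.symm y))ᶜ) := by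
    rw [relabel_preimage_closeEdges_preimage, Set.preimage_inter, Set.preimage_compl, relabel_preimage_openConn]
  rw [hmap ((measurableSet_mem _).inter (hH₀.preimage (hcl x y))), hmap ((hH₀.inter hK).preimage (hcl x y)),
    hmap ((hH₀.inter hK.compl).preimage (hcl x y)), h1, h2, h3]
  exact hP.real_edgeOpen_inter_preimage_eq hp hq hxy' (hH₀.preimage hτ)

/-- **`R_{p,q}` is translation-invariant as a set**: the shift `ω ↦ ω + v` carries DLR random-cluster measures to DLR
random-cluster measures (`0 ≤ p ≤ 1`, `q > 0`, every `v ∈ ℤ^d`). [cite: Grimmett2006, Thm. (4.19)(b), Def. (4.29)] -/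
theorem IsDLRRandomCluster.map_relabel_shift (hP : IsDLRRandomCluster d p q P) (hp : p ∈ Set.Icc (0 : ℝ) 1)
    (hq : 0 < q) (v : Site d) :
    IsDLRRandomCluster d p q (P.map ⇑(BondConfig.relabel (sym2Equiv (Site.shift v)))) :=
  hP.map_relabel_iso hp hq { toEquiv := Site.shift v, map_rel_iff' := fun {a b} => zdGraph_adj_shift_iff v a b }

/-- **`R_{p,q}` is invariant under the signed coordinate permutations** `Site.signedPerm π ε` (the automorphisms of
`ℤ^d` fixing the origin; with the translations they generate `Aut(ℤ^d)`). [cite: Grimmett2006, Thm. (4.19)(b) (proof,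
p. 78), Def. (4.29)] -/
theorem IsDLRRandomCluster.map_relabel_signedPerm (hP : IsDLRRandomCluster d p q P) (hp : p ∈ Set.Icc (0 : ℝ) 1)
    (hq : 0 < q) (π : Equiv.Perm (Fin d)) (ε : Fin d → ℤˣ) :
    IsDLRRandomCluster d p q (P.map ⇑(BondConfig.relabel (sym2Equiv (Site.signedPerm π ε)))) :=
  hP.map_relabel_iso hp hq (zdSignedPermIso π ε)

/-- **The relabelling by an automorphism of `ℤ^d` carries lattice-carried measures to lattice-carried measures**: if
`P`-a.e. `ω ⊆ E(ℤ^d)` then `(P ∘ τ⁻¹)`-a.e. `ω ⊆ E(ℤ^d)`, `τ = BondConfig.relabel (sym2Equiv φ)` (a graph automorphism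
maps the edge set onto itself, `sym2Equiv_mem_edgeSet_iff`). [folklore] -/
theorem ae_subset_edgeSet_map_relabel_iso (φ : zdGraph d ≃g zdGraph d) (hlat : ∀ᵐ ω ∂P, ω ⊆ (zdGraph d).edgeSet) :
    ∀ᵐ ω ∂(P.map ⇑(BondConfig.relabel (sym2Equiv φ.toEquiv))), ω ⊆ (zdGraph d).edgeSet := by
  rw [(BondConfig.relabel (sym2Equiv φ.toEquiv)).measurableEmbedding.ae_map_iff]
  filter_upwards [hlat] with ω hω z hz
  rw [BondConfig.mem_relabel_iff, sym2Equiv_symm] at hz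
  exact (sym2Equiv_mem_edgeSet_iff φ.symm z).1 (hω hz)

/-- **If the lattice-carried DLR random-cluster measure is unique, it is invariant under every automorphism of `ℤ^d`**
(in particular translation-invariant): for a lattice-carried `P ∈ R_{p,q}` (`P`-a.e. `ω ⊆ E(ℤ^d)`) which is the ONLY
lattice-carried member of `R_{p,q}`, `P ∘ τ⁻¹ = P` for every graph automorphism `φ`, since the image measure is again a
lattice-carried member of `R_{p,q}` (`IsDLRRandomCluster.map_relabel_iso`, `ae_subset_edgeSet_map_relabel_iso`).
Uniqueness is stated among LATTICE-CARRIED members only: `BondConfig (Site d) = Set (Sym2 (Site d))` contains non-edge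
pairs (e.g. the diagonal `s(x, x)`) which the DLR kernels never touch, so `R_{p,q}` as typed is never a singleton
(coordinator fk-4 g198, R95 finding (6), re-cut (θ2)); the hypothesis holds e.g. for `P = φ⁰_{p,q}`, `q ≥ 1`, at every
`p` off the countable set of `countable_setOf_exists_isDLRRandomCluster_ne_rcLimit` (`InfiniteVolumeDLRInterlacing.lean`).
[cite: Grimmett2006, Thm. (4.19)(b), (4.33)–(4.34)] -/
theorem IsDLRRandomCluster.map_relabel_iso_eq_self_of_forall_eq (hP : IsDLRRandomCluster d p q P)
    (hp : p ∈ Set.Icc (0 : ℝ) 1) (hq : 0 < q) (hlat : ∀ᵐ ω ∂P, ω ⊆ (zdGraph d).edgeSet)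
    (huniq : ∀ ⦃P₁ : Measure (BondConfig (Site d))⦄, IsDLRRandomCluster d p q P₁ →
      (∀ᵐ ω ∂P₁, ω ⊆ (zdGraph d).edgeSet) → P₁ = P)
    (φ : zdGraph d ≃g zdGraph d) : P.map ⇑(BondConfig.relabel (sym2Equiv φ.toEquiv)) = P :=
  huniq (hP.map_relabel_iso hp hq φ) (ae_subset_edgeSet_map_relabel_iso φ hlat)

end Invariance

end Summit.CriticalPhenomena.PercolationContinuityZ3.Theorems.FK

end
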